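import Summits.Parity.GeneralizedHardyLittlewood.Theorems.BeyondDiagonalBeatsQuarter.OffDiagCoreLevels
import Summits.Parity.GeneralizedHardyLittlewood.Theorems.BeyondDiagonalBeatsQuarter.OffDiagShiftedLatticeTail
import HarnessLib

/-!
# Route `PrimeLevelFamEdge`, crux K_B (stmt-Parity-20343), line `diagonal_kernel_split` rev 4, plan Ω —
# L7d part 2, node D5a applied, `OffDiagCoreLevelsTrunc`: **the `s`-TRUNCATION of the switched pieces — a piece with a
# bounded cell weight equals its FINITE `(cell, h₁, |s| ≤ S*)`-family plus a tail controlled by the shifted-lattice tails of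
# the box transforms (`OffDiagShiftedLatticeTail`)**

L7D-PLAN §3 (D5a applied). `OffDiagCoreLevels.coreWithW_eq_levels` writes a piece `coreWithW W G Hf Δ′` as the q-free cell
nest of `Σ_{|h₁| ≤ H*} Σ'_{s ∈ ℤ} Σ_{q∈G} levelSummand …`; the large sieve (D5b) needs a FINITE family. For a level-free
truncation height `S* = S*(cell, h₁)`:

* `tsum_eq_sum_Icc_add_tsum_ite` — `Σ'_s g s = Σ_{|s| ≤ S} g s + Σ'_s 𝟙[S < |s|]·g s` for summable `g`;
* **`coreWithW_eq_trunc_add_tail`** — `coreWithW W G Hf Δ′ = coreTrunc W Sf G Hf Δ′ + coreTailS W Sf G Hf Δ′` (definitions: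
  the finite family and the `s`-tail, same nest);
* **`abs_coreTailS_le`** — for `‖W‖ ≤ 1`, levels `N ≤ q` on `G`, and `S*(cell,h₁) = T(cell,h₁) + ⌈|ab|/(N(r+1))⌉₊`:
  `|coreTailS| ≤ Σ_{nest} Σ_{|h₁|≤H*} Σ_{q∈G} 𝟙[h₁ unit mod q(r+1)]·‖c_{cell}(q)‖·Σ'_s 𝟙[T < |s + ab/(q(r+1))|]·‖Φ̂_q(h₁/(q(r+1)), s/h₁ + ab/(h₁q(r+1)))‖`
  — each inner series is `OffDiagShiftedLatticeTail.tsum_shifted_tail_norm_fourier2_boxWeight_le`'s object (shift `u = ab/(q(r+1))`),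
  so with `T − 1 ≥ |h₁|·D₂·q^{ε₀}/(2π)` the tail is `O(S₂·T·q^{−kε₀})` per `(cell, h₁, q)`; the monomial count to `ε·Σms` is D5a′
  (`OffDiagCoreLevelsTruncCount`, K2-shaped).

Finite algebra and `tsum` bookkeeping; definitions + theorems; standard axioms. Helper toward `stub_offDiagBelowSlack_io`; closes nothing.
«The programme SEARCHES and TYPES; no claim about Landau–Siegel zeros, Theorems 1–2 of arXiv:2211.02515 or
a repaired Margin232 until a kernel theorem says so.»
-/

noncomputable section

open Finset Polynomial
open scoped Real FourierTransform

namespace Summit.Parity.GeneralizedHardyLittlewood.Theorems.BeyondDiagonalBeatsQuarter.OffDiag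

open Literature.NumberTheory.LFunctions Literature.NumberTheory.LFunctions.KMV2000
open Literature.NumberTheory.Sieve.FriedlanderIwaniecPrimes (fourier2)
open PeterssonSplit (nearBoxes)

/-! ### §1. Splitting an `s`-series at `|s| ≤ S` -/

/-- `Σ'_s g s = Σ_{s ∈ [−S, S]} g s + Σ'_s 𝟙[S < |s|]·g s` for a summable `g : ℤ → ℂ`. [folklore] -/
theorem tsum_eq_sum_Icc_add_tsum_ite {g : ℤ → ℂ} (hg : Summable g) (S : ℕ) :
    ∑' s : ℤ, g s = ∑ s ∈ Icc (-(S : ℤ)) S, g s + ∑' s : ℤ, (if (S : ℤ) < |s| then g s else 0) := by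
  classical
  have hsplit : ∀ s : ℤ, g s = (if |s| ≤ (S : ℤ) then g s else 0) + (if (S : ℤ) < |s| then g s else 0) := by
    intro s
    by_cases h : |s| ≤ (S : ℤ)
    · rw [if_pos h, if_neg (not_lt.mpr h), add_zero]
    · rw [if_neg h, if_pos (not_le.mp h), zero_add]
  have h1 : Summable fun s : ℤ ↦ (if |s| ≤ (S : ℤ) then g s else 0) := by
    refine (hg.indicator {s : ℤ | |s| ≤ (S : ℤ)}).congr fun s ↦ ?_
    simp only [Set.indicator_apply, Set.mem_setOf_eq]
  have h2 : Summable fun s : ℤ ↦ (if (S : ℤ) < |s| then g s else 0) := by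
    refine (hg.indicator {s : ℤ | (S : ℤ) < |s|}).congr fun s ↦ ?_
    simp only [Set.indicator_apply, Set.mem_setOf_eq]
  rw [tsum_congr hsplit, h1.tsum_add h2]
  congr 1
  rw [tsum_eq_sum (s := Icc (-(S : ℤ)) S)]
  · refine Finset.sum_congr rfl fun s hs ↦ ?_
    rw [Finset.mem_Icc] at hs
    rw [if_pos (abs_le.mpr hs)]
  · intro s hs
    rw [Finset.mem_Icc, ← abs_le] at hs
    rw [if_neg hs]

/-! ### §2. The truncated family and the `s`-tail of a piece -/

open Classical in
/-- **The truncated (finite) family of a switched piece**: the cell nest at the block top `Q` with `|h₁| ≤ H*(cell)` and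
`|s| ≤ Sf(cell, h₁)`, level sum innermost. [cite: KowalskiMichelVanderKam2000, §6 p. 19, (21)–(23) p. 12 — derivation] -/
def coreTrunc (W : ℕ → ℕ → ℕ → ℕ → ℕ → ℕ → ℕ × ℕ → ℤ → ℤ → ℂ) (Sf : ℕ → ℕ → ℕ → ℕ → ℕ → ℕ × ℕ → ℤ → ℕ)
    (G : Finset ℕ) (Q : ℕ) (Hf : ℕ → ℕ → ℕ → ℕ → ℕ → ℕ → ℕ × ℕ → ℕ) (Δ' : ℝ) : ℝ :=
  -((∑ r ∈ Finset.range (Q ^ 7), ∑ l ∈ Finset.Icc 1 ⌊qhat Q ^ Δ'⌋₊, ∑ m ∈ Finset.Icc 1 ⌊qhat Q ^ Δ'⌋₊,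
      ∑ d₁ ∈ l.divisors, ∑ d₂ ∈ m.divisors, ∑ i ∈ nearBoxes Q d₁ d₂ (Real.log Q ^ 4),
        if Nat.Coprime (l / d₁) (r + 1) then
          ∑ h₁ ∈ Icc (-((G.sup (fun q ↦ Hf q d₁ d₂ (l / d₁) (m / d₂) (r + 1) i) : ℕ) : ℤ))
              ((G.sup (fun q ↦ Hf q d₁ d₂ (l / d₁) (m / d₂) (r + 1) i) : ℕ) : ℤ),
            ∑ s ∈ Icc (-(Sf r l m d₁ d₂ i h₁ : ℤ)) (Sf r l m d₁ d₂ i h₁), ∑ q ∈ G,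
              levelSummand (fun q ↦ if r < q ^ 7 ∧ l ≤ ⌊qhat q ^ Δ'⌋₊ ∧ m ≤ ⌊qhat q ^ Δ'⌋₊ ∧
                    i ∈ nearBoxes q d₁ d₂ (Real.log q ^ 4) then
                  2 * (qhat q : ℂ) * (2 * π / q) *
                    (((mollifierCoeff (X ^ 2) (qhat q ^ Δ') l * mollifierCoeff (X ^ 2) (qhat q ^ Δ') m : ℝ) : ℂ))
                else 0) W Hf r l m d₁ d₂ i h₁ s q
        else 0).re)

open Classical in
/-- **The `s`-tail of a switched piece** beyond `|s| ≤ Sf(cell, h₁)` (same nest, the `s`-series restricted to `Sf < |s|`).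
[cite: KowalskiMichelVanderKam2000, §6 p. 19 — derivation] -/
def coreTailS (W : ℕ → ℕ → ℕ → ℕ → ℕ → ℕ → ℕ × ℕ → ℤ → ℤ → ℂ) (Sf : ℕ → ℕ → ℕ → ℕ → ℕ → ℕ × ℕ → ℤ → ℕ)
    (G : Finset ℕ) (Q : ℕ) (Hf : ℕ → ℕ → ℕ → ℕ → ℕ → ℕ → ℕ × ℕ → ℕ) (Δ' : ℝ) : ℝ :=
  -((∑ r ∈ Finset.range (Q ^ 7), ∑ l ∈ Finset.Icc 1 ⌊qhat Q ^ Δ'⌋₊, ∑ m ∈ Finset.Icc 1 ⌊qhat Q ^ Δ'⌋₊,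
      ∑ d₁ ∈ l.divisors, ∑ d₂ ∈ m.divisors, ∑ i ∈ nearBoxes Q d₁ d₂ (Real.log Q ^ 4),
        if Nat.Coprime (l / d₁) (r + 1) then
          ∑ h₁ ∈ Icc (-((G.sup (fun q ↦ Hf q d₁ d₂ (l / d₁) (m / d₂) (r + 1) i) : ℕ) : ℤ))
              ((G.sup (fun q ↦ Hf q d₁ d₂ (l / d₁) (m / d₂) (r + 1) i) : ℕ) : ℤ),
            ∑' s : ℤ, (if (Sf r l m d₁ d₂ i h₁ : ℤ) < |s| then ∑ q ∈ G,
              levelSummand (fun q ↦ if r < q ^ 7 ∧ l ≤ ⌊qhat q ^ Δ'⌋₊ ∧ m ≤ ⌊qhat q ^ Δ'⌋₊ ∧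
                    i ∈ nearBoxes q d₁ d₂ (Real.log q ^ 4) then
                  2 * (qhat q : ℂ) * (2 * π / q) *
                    (((mollifierCoeff (X ^ 2) (qhat q ^ Δ') l * mollifierCoeff (X ^ 2) (qhat q ^ Δ') m : ℝ) : ℂ))
                else 0) W Hf r l m d₁ d₂ i h₁ s q else 0)
        else 0).re)

/-- `−re(A + B) = −re A + −re B` inside a six-fold nest: additivity helper. [folklore] -/
theorem neg_re_add (A B : ℂ) : -((A + B).re) = -(A.re) + -(B.re) := by
  rw [Complex.add_re, neg_add]

open Classical in
/-- **A switched piece is its truncated family plus its `s`-tail.** For levels `G` with `2 ≤ q ≤ Q` on `G`, `Δ′ ≥ 0`, a bounded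
weight and any truncation function `Sf`:
`coreWithW W G Hf Δ′ = coreTrunc W Sf G Q Hf Δ′ + coreTailS W Sf G Q Hf Δ′`. [folklore] -/
theorem coreWithW_eq_trunc_add_tail {W : ℕ → ℕ → ℕ → ℕ → ℕ → ℕ → ℕ × ℕ → ℤ → ℤ → ℂ} {B : ℝ}
    (hW : ∀ q r l m d₁ d₂ i h₁ s, ‖W q r l m d₁ d₂ i h₁ s‖ ≤ B)
    (Sf : ℕ → ℕ → ℕ → ℕ → ℕ → ℕ × ℕ → ℤ → ℕ) (G : Finset ℕ) {Q : ℕ} (hG : ∀ q ∈ G, 2 ≤ q ∧ q ≤ Q)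
    (Hf : ℕ → ℕ → ℕ → ℕ → ℕ → ℕ → ℕ × ℕ → ℕ) {Δ' : ℝ} (hΔ : 0 ≤ Δ') :
    coreWithW W G Hf Δ' = coreTrunc W Sf G Q Hf Δ' + coreTailS W Sf G Q Hf Δ' := by
  rw [coreWithW_eq_levels hW G hG Hf hΔ, coreTrunc, coreTailS, ← neg_re_add, ← Finset.sum_add_distrib]
  refine neg_re_congr (Finset.sum_congr rfl fun r _ ↦ ?_)
  rw [← Finset.sum_add_distrib]
  refine Finset.sum_congr rfl fun l _ ↦ ?_
  rw [← Finset.sum_add_distrib]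
  refine Finset.sum_congr rfl fun m _ ↦ ?_
  rw [← Finset.sum_add_distrib]
  refine Finset.sum_congr rfl fun d₁ _ ↦ ?_
  rw [← Finset.sum_add_distrib]
  refine Finset.sum_congr rfl fun d₂ _ ↦ ?_
  rw [← Finset.sum_add_distrib]
  refine Finset.sum_congr rfl fun i _ ↦ ?_
  split_ifs with hcop
  · rw [← Finset.sum_add_distrib]
    refine Finset.sum_congr rfl fun h₁ _ ↦ ?_
    exact tsum_eq_sum_Icc_add_tsum_ite
      (summable_sum fun q hq ↦ summable_levelSummand _ hW Hf (hG q hq).1 r l m d₁ d₂ i h₁) _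
  · rw [add_zero]

/-! ### §3. The `s`-tail in terms of shifted-lattice tails of the box transforms -/

/-- For `|s| > T + ⌈|u|⌉` we have `|s + u| > T`. [folklore] -/
theorem lt_abs_add_of_lt_abs {s : ℤ} {u : ℝ} {T : ℕ} (h : ((T + ⌈|u|⌉₊ : ℕ) : ℤ) < |s|) :
    (T : ℝ) < |(s : ℝ) + u| := by
  have h1 : ((T : ℝ) + ⌈|u|⌉₊) < |(s : ℝ)| := by
    have : ((T + ⌈|u|⌉₊ : ℕ) : ℝ) < ((|s| : ℤ) : ℝ) := by exact_mod_cast h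
    rw [Int.cast_abs] at this
    push_cast at this
    exact this
  have h2 : |u| ≤ ⌈|u|⌉₊ := Nat.le_ceil _
  have h3 : |(s : ℝ)| ≤ |(s : ℝ) + u| + |u| := by
    have := abs_add_le ((s : ℝ) + u) (-u)
    rwa [add_neg_cancel_right, abs_neg] at this
  linarith

/-- The shift at level `q ≥ N` is at most the shift at level `N`: `|A/(q(r+1))| ≤ |A/(N(r+1))|`. [folklore] -/
theorem abs_shift_le {A : ℤ} {q N r : ℕ} (hN : 1 ≤ N) (hqN : N ≤ q) :
    |((A : ℤ) : ℝ) / ((q * (r + 1) : ℕ) : ℝ)| ≤ |((A : ℤ) : ℝ) / ((N : ℝ) * ((r + 1 : ℕ) : ℝ))| := by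
  have hr0 : (0 : ℝ) < ((r + 1 : ℕ) : ℝ) := by exact_mod_cast Nat.succ_pos r
  have hN0 : (0 : ℝ) < N := by exact_mod_cast hN
  have hq0 : (0 : ℝ) < q := by exact_mod_cast (lt_of_lt_of_le hN hqN)
  have hqc : (0 : ℝ) < ((q * (r + 1) : ℕ) : ℝ) := by push_cast; positivity
  have hle : ((N : ℝ) * ((r + 1 : ℕ) : ℝ)) ≤ ((q * (r + 1) : ℕ) : ℝ) := by
    have : (N : ℝ) * ((r + 1 : ℕ) : ℝ) ≤ (q : ℝ) * ((r + 1 : ℕ) : ℝ) :=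
      mul_le_mul_of_nonneg_right (by exact_mod_cast hqN) hr0.le
    push_cast at this ⊢
    linarith
  simp only [abs_div, abs_of_pos hqc, abs_of_pos (mul_pos hN0 hr0)]
  exact div_le_div_of_nonneg_left (abs_nonneg _) (mul_pos hN0 hr0) hle

open Classical in
/-- **One cell, one modulus: the `s`-tail of the level summands against the shifted-lattice tails.** For `‖W‖ ≤ 1`, levels `G`
with `2 ≤ q`, `N ≤ q` (`N ≥ 1`), a scalar level factor `c`, a height `T` and the truncation `T + ⌈|ab/(N(r+1))|⌉₊`:
`‖Σ'_s 𝟙[T + ⌈|ab/(N(r+1))|⌉ < |s|]·Σ_{q∈G} levelSummand c W Hf cell h₁ s q‖ ≤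
 Σ_{q∈G} 𝟙[h₁ unit mod q(r+1)]·‖c q‖·Σ'_s 𝟙[T < |s + ab/(q(r+1))|]·‖Φ̂_q(h₁/(q(r+1)), s/h₁ + ab/(h₁q(r+1)))‖`. [folklore] -/
theorem norm_tsum_tail_levelSummand_le {W : ℕ → ℕ → ℕ → ℕ → ℕ → ℕ → ℕ × ℕ → ℤ → ℤ → ℂ}
    (hW : ∀ q r l m d₁ d₂ i h₁ s, ‖W q r l m d₁ d₂ i h₁ s‖ ≤ 1) (c : ℕ → ℂ)
    (G : Finset ℕ) {N : ℕ} (hN : 1 ≤ N) (hG : ∀ q ∈ G, 2 ≤ q ∧ N ≤ q)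
    (Hf : ℕ → ℕ → ℕ → ℕ → ℕ → ℕ → ℕ × ℕ → ℕ) (r l m d₁ d₂ : ℕ) (i : ℕ × ℕ) (h₁ : ℤ) (T : ℕ) :
    ‖∑' s : ℤ, (if ((T + ⌈|((((l / d₁ : ℕ) : ℤ) * (m / d₂ : ℕ) : ℤ) : ℝ) / ((N : ℝ) * ((r + 1 : ℕ) : ℝ))|⌉₊ : ℕ) : ℤ) < |s|
        then ∑ q ∈ G, levelSummand c W Hf r l m d₁ d₂ i h₁ s q else 0)‖ ≤
      ∑ q ∈ G, (if IsUnit ((h₁ : ℤ) : ZMod (q * (r + 1))) then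
        ‖c q‖ * ∑' s : ℤ, (if (T : ℝ) < |(s : ℝ) + ((((l / d₁ : ℕ) : ℤ) * (m / d₂ : ℕ) : ℤ) : ℝ) / ((q * (r + 1) : ℕ) : ℝ)| then
          ‖fourier2 (boxWeight q d₁ d₂ (l / d₁) (m / d₂) (r + 1) i) (h₁ / (q * (r + 1) : ℕ))
            ((s : ℝ) / h₁ + (((l / d₁ : ℕ) : ℤ) * (m / d₂ : ℕ) : ℝ) / ((h₁ : ℝ) * (q * (r + 1) : ℕ)))‖ else 0)
        else 0) := by
  -- summability of each level's majorant term
  have hsumq : ∀ q ∈ G, Summable (fun s : ℤ ↦ (if IsUnit ((h₁ : ℤ) : ZMod (q * (r + 1))) then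
      ‖c q‖ * (if (T : ℝ) < |(s : ℝ) + ((((l / d₁ : ℕ) : ℤ) * (m / d₂ : ℕ) : ℤ) : ℝ) / ((q * (r + 1) : ℕ) : ℝ)| then
        ‖fourier2 (boxWeight q d₁ d₂ (l / d₁) (m / d₂) (r + 1) i) (h₁ / (q * (r + 1) : ℕ))
          ((s : ℝ) / h₁ + (((l / d₁ : ℕ) : ℤ) * (m / d₂ : ℕ) : ℝ) / ((h₁ : ℝ) * (q * (r + 1) : ℕ)))‖ else 0) else 0)) := by
    intro q hq
    by_cases hu : IsUnit ((h₁ : ℤ) : ZMod (q * (r + 1)))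
    swap
    · simp only [if_neg hu]; exact summable_zero
    simp only [if_pos hu]
    have hq2 := (hG q hq).1
    have hC : 2 ≤ q * (r + 1) := le_trans hq2 (Nat.le_mul_of_pos_right q (Nat.succ_pos r))
    haveI : NeZero (q * (r + 1)) := ⟨by omega⟩
    haveI : NeZero q := ⟨by omega⟩
    have hh₁ : h₁ ≠ 0 := intCast_ne_zero_of_isUnit hC hu
    have hΦ := summable_fourier2_boxWeight_intShift q d₁ d₂ (l / d₁) (m / d₂) (r + 1) i
      ((h₁ : ℝ) / (q * (r + 1) : ℕ)) ((((l / d₁ : ℕ) : ℤ) * (m / d₂ : ℕ) : ℝ) / ((h₁ : ℝ) * (q * (r + 1) : ℕ))) hh₁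
    refine Summable.of_nonneg_of_le (fun s ↦ by positivity) (fun s ↦ ?_) (hΦ.norm.mul_left ‖c q‖)
    split_ifs
    · exact le_refl _
    · exact mul_le_mul_of_nonneg_left (norm_nonneg _) (norm_nonneg _)
  -- pointwise majorant of the tail summand
  have hpt : ∀ s : ℤ, ‖(if ((T + ⌈|((((l / d₁ : ℕ) : ℤ) * (m / d₂ : ℕ) : ℤ) : ℝ) / ((N : ℝ) * ((r + 1 : ℕ) : ℝ))|⌉₊ : ℕ) : ℤ) < |s|
        then ∑ q ∈ G, levelSummand c W Hf r l m d₁ d₂ i h₁ s q else 0)‖ ≤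
      ∑ q ∈ G, (if IsUnit ((h₁ : ℤ) : ZMod (q * (r + 1))) then
        ‖c q‖ * (if (T : ℝ) < |(s : ℝ) + ((((l / d₁ : ℕ) : ℤ) * (m / d₂ : ℕ) : ℤ) : ℝ) / ((q * (r + 1) : ℕ) : ℝ)| then
          ‖fourier2 (boxWeight q d₁ d₂ (l / d₁) (m / d₂) (r + 1) i) (h₁ / (q * (r + 1) : ℕ))
            ((s : ℝ) / h₁ + (((l / d₁ : ℕ) : ℤ) * (m / d₂ : ℕ) : ℝ) / ((h₁ : ℝ) * (q * (r + 1) : ℕ)))‖ else 0) else 0) := by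
    intro s
    split_ifs with hS
    swap
    · rw [norm_zero]
      exact Finset.sum_nonneg fun q _ ↦ by split_ifs <;> positivity
    refine norm_sum_le_of_le _ fun q hq ↦ ?_
    have hshift : (T : ℝ) < |(s : ℝ) + ((((l / d₁ : ℕ) : ℤ) * (m / d₂ : ℕ) : ℤ) : ℝ) / ((q * (r + 1) : ℕ) : ℝ)| := by
      refine lt_abs_add_of_lt_abs (lt_of_le_of_lt ?_ hS)
      exact_mod_cast Nat.add_le_add_left (Nat.ceil_mono (abs_shift_le (A := ((l / d₁ : ℕ) : ℤ) * (m / d₂ : ℕ))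
        (r := r) hN (hG q hq).2)) T
    unfold levelSummand
    by_cases hH : |h₁| ≤ (Hf q d₁ d₂ (l / d₁) (m / d₂) (r + 1) i : ℤ)
    swap
    · rw [if_neg hH, norm_zero]; split_ifs <;> positivity
    rw [if_pos hH]
    by_cases hu : IsUnit ((h₁ : ℤ) : ZMod (q * (r + 1)))
    swap
    · rw [if_neg hu, if_neg hu, norm_zero]
    rw [if_pos hu, if_pos hu, if_pos hshift]
    split_ifs with hadm
    · rw [norm_mul, norm_mul]
      refine mul_le_mul_of_nonneg_left ?_ (norm_nonneg _)
      calc ‖W q r l m d₁ d₂ i h₁ s‖ * _ ≤ 1 * _ := mul_le_mul_of_nonneg_right (hW q r l m d₁ d₂ i h₁ s) (norm_nonneg _)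
        _ = _ := one_mul _
    · rw [norm_zero]; positivity
  have hGsum := summable_sum hsumq
  have hFsum := Summable.of_nonneg_of_le (fun s ↦ norm_nonneg _) hpt hGsum
  refine (norm_tsum_le_tsum_norm hFsum).trans ((hFsum.tsum_le_tsum hpt hGsum).trans (le_of_eq ?_))
  rw [Summable.tsum_finsetSum hsumq]
  refine Finset.sum_congr rfl fun q _ ↦ ?_
  by_cases hu : IsUnit ((h₁ : ℤ) : ZMod (q * (r + 1)))
  · simp only [if_pos hu]
    rw [tsum_mul_left]
  · simp only [if_neg hu, tsum_zero]

open Classical in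
/-- **The `s`-tail of a piece is controlled by the shifted-lattice tails of the box transforms.** For `‖W‖ ≤ 1`, levels `G`
with `2 ≤ q`, `N ≤ q` on `G` (`N ≥ 1`), any `Δ′`, `Hf`, `Q`, a height function `T(cell, h₁)` and the truncation
`Sf(cell, h₁) = T + ⌈|(l/d₁)(m/d₂)/(N(r+1))|⌉₊`:
`|coreTailS W Sf G Q Hf Δ′| ≤ Σ_{nest} 𝟙[cop]·Σ_{|h₁| ≤ H*} Σ_{q∈G} 𝟙[h₁ unit mod q(r+1)]·‖c_{cell}(q)‖·
   Σ'_s 𝟙[T < |s + ab/(q(r+1))|]·‖Φ̂_q(h₁/(q(r+1)), s/h₁ + ab/(h₁q(r+1)))‖`. [folklore] -/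
theorem abs_coreTailS_le {W : ℕ → ℕ → ℕ → ℕ → ℕ → ℕ → ℕ × ℕ → ℤ → ℤ → ℂ}
    (hW : ∀ q r l m d₁ d₂ i h₁ s, ‖W q r l m d₁ d₂ i h₁ s‖ ≤ 1)
    (T : ℕ → ℕ → ℕ → ℕ → ℕ → ℕ × ℕ → ℤ → ℕ) (G : Finset ℕ) {Q N : ℕ} (hN : 1 ≤ N)
    (hG : ∀ q ∈ G, 2 ≤ q ∧ N ≤ q) (Hf : ℕ → ℕ → ℕ → ℕ → ℕ → ℕ → ℕ × ℕ → ℕ) (Δ' : ℝ) :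
    |coreTailS W (fun r l m d₁ d₂ i h₁ ↦ T r l m d₁ d₂ i h₁ +
        ⌈|((((l / d₁ : ℕ) : ℤ) * (m / d₂ : ℕ) : ℤ) : ℝ) / ((N : ℝ) * ((r + 1 : ℕ) : ℝ))|⌉₊) G Q Hf Δ'| ≤
      ∑ r ∈ Finset.range (Q ^ 7), ∑ l ∈ Finset.Icc 1 ⌊qhat Q ^ Δ'⌋₊, ∑ m ∈ Finset.Icc 1 ⌊qhat Q ^ Δ'⌋₊,
        ∑ d₁ ∈ l.divisors, ∑ d₂ ∈ m.divisors, ∑ i ∈ nearBoxes Q d₁ d₂ (Real.log Q ^ 4),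
          if Nat.Coprime (l / d₁) (r + 1) then
            ∑ h₁ ∈ Icc (-((G.sup (fun q ↦ Hf q d₁ d₂ (l / d₁) (m / d₂) (r + 1) i) : ℕ) : ℤ))
                ((G.sup (fun q ↦ Hf q d₁ d₂ (l / d₁) (m / d₂) (r + 1) i) : ℕ) : ℤ),
              ∑ q ∈ G, (if IsUnit ((h₁ : ℤ) : ZMod (q * (r + 1))) then
                ‖(if r < q ^ 7 ∧ l ≤ ⌊qhat q ^ Δ'⌋₊ ∧ m ≤ ⌊qhat q ^ Δ'⌋₊ ∧ i ∈ nearBoxes q d₁ d₂ (Real.log q ^ 4) then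
                    2 * (qhat q : ℂ) * (2 * π / q) *
                      (((mollifierCoeff (X ^ 2) (qhat q ^ Δ') l * mollifierCoeff (X ^ 2) (qhat q ^ Δ') m : ℝ) : ℂ))
                  else 0)‖ *
                ∑' s : ℤ, (if (T r l m d₁ d₂ i h₁ : ℝ) <
                    |(s : ℝ) + ((((l / d₁ : ℕ) : ℤ) * (m / d₂ : ℕ) : ℤ) : ℝ) / ((q * (r + 1) : ℕ) : ℝ)| then
                  ‖fourier2 (boxWeight q d₁ d₂ (l / d₁) (m / d₂) (r + 1) i) (h₁ / (q * (r + 1) : ℕ))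
                    ((s : ℝ) / h₁ + (((l / d₁ : ℕ) : ℤ) * (m / d₂ : ℕ) : ℝ) / ((h₁ : ℝ) * (q * (r + 1) : ℕ)))‖ else 0)
                else 0)
          else 0 := by
  unfold coreTailS
  rw [abs_neg]
  refine (Complex.abs_re_le_norm _).trans ?_
  refine norm_sum_le_of_le _ fun r _ ↦ norm_sum_le_of_le _ fun l _ ↦ norm_sum_le_of_le _ fun m _ ↦
    norm_sum_le_of_le _ fun d₁ _ ↦ norm_sum_le_of_le _ fun d₂ _ ↦ norm_sum_le_of_le _ fun i _ ↦ ?_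
  by_cases hcop : Nat.Coprime (l / d₁) (r + 1)
  swap
  · rw [if_neg hcop, if_neg hcop, norm_zero]
  rw [if_pos hcop, if_pos hcop]
  refine norm_sum_le_of_le _ fun h₁ _ ↦ ?_
  exact norm_tsum_tail_levelSummand_le hW _ G hN hG Hf r l m d₁ d₂ i h₁ (T r l m d₁ d₂ i h₁)

end Summit.Parity.GeneralizedHardyLittlewood.Theorems.BeyondDiagonalBeatsQuarter.OffDiag
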